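import Summits.BirchSwinnertonDyer.BirchSwinnertonDyer.Theorems.EdixhovenFibreFiveSevenStarredOptimalManinUnitFiveSevenTowerRangeAt
import Summits.BirchSwinnertonDyer.BirchSwinnertonDyer.Theorems.EdixhovenFibreFiveSevenStarredOptimalManinUnitFiveSevenSemiLocalIntegralityPinAt
import Literature.NumberTheory.EllipticCurves.DualExpEllipticReciprocityLaw
import HarnessLib

/-!
# [REC-tower] AT A TOWER `ℚ_v ⊆ L` ⟹ (S5b-tower) AT THAT TOWER — the pointwise form of p700964, and v6 ⟹ v7 of the K★ skeleton
# (route `EdixhovenFibreFiveSeven`, crux K★ stmt-BirchSwinnertonDyer-22226, line `kato-lever`; seat `bsd-line-edix-p1` g29, LEAD)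

HONEST FRAMING. TOOL theorems only (no definition, no named fact, no `sorry`; file-local instance keys on `ℚ_v` byte-identical to
`…SemiLocalIntegralityPinAt` l.164–169 / `…TowerRangeAt`, needed only to STATE the bodies of the two cite facts at `ℚ_v`); nothing is closed;
BSD / K★ are NOT proved by this. Part of the SEAM re-key chain `…TowerRangeAt` → `…SemiLocalIntegralityOfRangeAt` → `…AssemblyAtBarOfRangeAt`
→ `…CellsOfRecTowerAt` (memo `Cruxes/StarredOptimalManinUnitFiveSeven/Lines/kato-lever-seam-rec-at-cells.md`).

* §1 ★ `rangeAt_of_recTowerAt` — the body of Kato's explicit reciprocity law [REC-tower] `tatePairingPoint_eq_trace_expStar_log_tower` AT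
  `(K₀ = ℚ, W, F₀ = ℚ_v, F = L)` (∀ Weil towers `e`, both line data, Prop-1.2.3 binders, compatibility) ⟹ the body of (S5b-tower) AT
  `(W, ℚ_v ⊆ L)` (= the hypothesis `hT₂W` of `…TowerRangeAt.exists_smul_ranges_of_rangeAt`): ONE application of
  `PAdicHodge.exists_smul_range_tower_of_reciprocity` with [TD] `exists_contOneCocycles_tatePairingPoint(Tower)_eq`, [N]
  `eq_zero_of_forall_trace_mul_padicLog_baseChange_eq_zero`, [ADD] `padicLogPointFiniteExt_baseChange_add` and the Weil tower
  `exists_weilPairing_torsionMul_tower` — all tree theorems (pointwise reading of `exists_smul_range_expStarCoord_tower_iff_trace_log_of_reciprocityLaw`).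
* §2 ★ `recTowerAt_cyclotomic_of_reciprocityLaw` — the ∀-fields cite fact [REC-tower] (stub of skeleton v6) implies its body at every curve `W′/ℚ`
  and every cyclotomic tower `ℚ_v ⊆ ℚ(ζ_m)_w` in the packet's instance keys — so the cell-restricted stubs of skeleton v7
  (`…CellsOfRecTowerAt`) are NOT stronger than v6's stub.

References: [Kato1993LNM1553] Ch. II §1.2.4, Thm. 1.4.1 (3)–(4), Lemma 1.4.3–1.4.5; [BlochKato1990] Prop. 3.8, Ex. 3.11; [MilneADT2006] I §3 Cor. 3.4.
-/

set_option autoImplicit false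
-- the Theorems namespace of a single-conjunct summit repeats the summit name by design (D-0017)
set_option linter.dupNamespace false

noncomputable section

open scoped Classical MatrixGroups NumberField NNReal

open WeierstrassCurve NumberField IsDedekindDomain Field ValuativeRel
  Literature.NumberTheory.EllipticCurves Literature.NumberTheory.EllipticCurves.ModularForms
  Literature.NumberTheory.EllipticCurves.Rank1Residual Literature.NumberTheory.EllipticCurves.Kato2004
  Literature.NumberTheory.DiophantineGeometry Rat.HeightOneSpectrum
  Literature.NumberTheory.PAdicHodge Literature.NumberTheory.GaloisRepresentations
  Literature.NumberTheory.GaloisRepresentations.IsNonarchimedeanLocalField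
  Literature.NumberTheory.GaloisRepresentations.PeriodRingData
  Summit.BirchSwinnertonDyer.Rank1Residual Summit.BirchSwinnertonDyer.Rank1Residual.Additive
  Summit.BirchSwinnertonDyer.Rank1Residual.GaloisImage
  Summit.BirchSwinnertonDyer.BirchSwinnertonDyer.Theorems
  Summit.BirchSwinnertonDyer.BirchSwinnertonDyer.Theorems.KimAtThreeDeepLowerExpStarOmega
  Summit.BirchSwinnertonDyer.BirchSwinnertonDyer.Theorems.KimAtThreeDeepLowerExpStarOmegaPlace
  Summit.BirchSwinnertonDyer.BirchSwinnertonDyer.Theorems.KimAtThreeDeepLowerExpStarOmegaRes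
  Summit.BirchSwinnertonDyer.BirchSwinnertonDyer.Theorems.KimAtThreeDeepUpperExpStarTransport
  Summit.BirchSwinnertonDyer.BirchSwinnertonDyer.Theorems.KimAtThreeDeepUpperExpStarFacts
  Summit.BirchSwinnertonDyer.BirchSwinnertonDyer.Theorems.KimAtThreeDeepUpperExpStarFactsCanonical
open Summit.BirchSwinnertonDyer.BirchSwinnertonDyer.Theorems.KimAtThreeDeepUpperTowerLattice (fact_natCast_mem_primesEquiv_symm)
open Literature.NumberTheory.EllipticCurves.FormalGroupChart (padicLogPointFiniteExt)
open CategoryTheory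

namespace Summit.BirchSwinnertonDyer.BirchSwinnertonDyer.Theorems.StarredOptimalManinUnitFiveSevenRecTowerAtBridge

-- FILE-LOCAL instance keys, byte-identical to the accepted `…SemiLocalIntegralityPinAt.lean` l.164–169 (no library instance is
-- overridden outside this file): the `Fact (p ∈ v_p)` key and the local-field structures on `ℚ_v = Place.Completion (inr v)`, under
-- which the bodies of (S5b-tower) / [REC-tower] at `ℚ_v ⊆ L` are stated.
attribute [local instance] fact_natCast_mem_primesEquiv_symm
attribute [local instance 100000] NumberField.Place.instAlgebraCompletion
attribute [local instance] valuativeRelPlace topologicalSpacePlace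
attribute [local instance] isNonarchimedeanLocalField_place charZero_place
attribute [local instance] padicAlgebraPlace fact_not_isUnit_place isAdicComplete_place

/-! ## §1 [REC-tower] at a tower ⟹ (S5b-tower) at that tower (pointwise form of p700964) -/

section Bridge

variable (W : WeierstrassCurve ℚ) [W.IsElliptic] (p : ℕ) [Fact p.Prime]
  (v : HeightOneSpectrum (𝓞 ℚ)) [hv : Fact (((p : ℕ) : 𝓞 ℚ) ∈ v.asIdeal)]
  {L : Type} [Field L] [ValuativeRel L] [TopologicalSpace L] [IsNonarchimedeanLocalField L]
  [CharZero L] [Algebra ℚ L] [Algebra (Place.Completion (Sum.inr v : Place ℚ)) L]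
  [Fact (¬ IsUnit (p : integerC L))] [IsAdicComplete (Ideal.span {(p : integerC L)}) (integerC L)]
  (hL : valuation L p < 1) [Algebra ℚ_[p] L]

/-- ★ **[REC-tower] at the tower `ℚ_v ⊆ L` ⟹ (S5b-tower) at the tower `ℚ_v ⊆ L`** (pointwise form of
`exists_smul_range_expStarCoord_tower_iff_trace_log_of_reciprocityLaw`, p700964). Hypothesis: the body of Kato's explicit reciprocity law
`tatePairingPoint_eq_trace_expStar_log_tower` at `K₀ = ℚ`, THIS `W`, `F₀ = ℚ_v`, `F = L` — for every Weil tower `e`, both line data `d₀`, `d`,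
the Prop-1.2.3 binders and the compatibility clause, ONE `c ∈ ℚ_vˣ` with `⟨[η₀], P₀⟩ = Tr_{ℚ_v/ℚ_p}(c · exp*_{d₀}(η₀) · log_ω P₀)` and
`⟨[η], P⟩ = Tr_{L/ℚ_p}(c · exp*_d(η) · log_ω P)`. Conclusion: the hypothesis `hT₂W` of `…TowerRangeAt.exists_smul_ranges_of_rangeAt` (ONE
rescaling `e` putting `range(exp*)` at both levels onto the trace dual of `log_ω E`). Proof: the Weil tower of `exists_weilPairing_torsionMul_tower`,
then `PAdicHodge.exists_smul_range_tower_of_reciprocity` with [TD] `exists_contOneCocycles_tatePairingPoint(Tower)_eq`, [N]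
`eq_zero_of_forall_trace_mul_padicLog_baseChange_eq_zero`, [ADD] `padicLogPointFiniteExt_baseChange_add`.
[cite: Kato1993LNM1553, Ch. II Thm. 1.4.1 (3)–(4) and §1.2.4] [cite: BlochKato1990, Prop. 3.8 (p. 354), Example 3.11 (p. 361)]
[cite: MilneADT2006, I §3 Cor. 3.4] -/
theorem rangeAt_of_recTowerAt
    (hrec : ∀ (w₀ : Valuation (Place.Completion (Sum.inr v : Place ℚ)) ℝ≥0) [w₀.Compatible]
        [(W.baseChange (Place.Completion (Sum.inr v : Place ℚ))).IsIntegral w₀.integer]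
        (ν : Valuation L ℝ≥0) [ν.Compatible] [(W.baseChange L).IsIntegral ν.integer]
        (e : (k : ℕ) → geomTorsion W ((p ^ k : ℕ) : ℤ) → geomTorsion W ((p ^ k : ℕ) : ℤ) → AlgebraicClosure ℚ)
        (hμ : ∀ k S T, e k S T ^ (p ^ k) = 1)
        (hadd₁ : ∀ k S₁ S₂ T, e k (S₁ + S₂) T = e k S₁ T * e k S₂ T)
        (hadd₂ : ∀ k S T₁ T₂, e k S (T₁ + T₂) = e k S T₁ * e k S T₂)
        (hgal : ∀ k (σ : absoluteGaloisGroup ℚ) (S T : geomTorsion W ((p ^ k : ℕ) : ℤ)), σ • e k S T = e k (σ • S) (σ • T))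
        (_hnondeg : ∀ k (T : geomTorsion W ((p ^ k : ℕ) : ℤ)), (∀ S, e k S T = 1) → T = 0)
        (hcompat : ∀ k (S T : geomTorsion W ((p ^ (k + 1) : ℕ) : ℤ)),
          e k (torsionMulHom W (p ^ (k + 1)) (p ^ k) p (pow_succ p k).symm S)
            (torsionMulHom W (p ^ (k + 1)) (p ^ k) p (pow_succ p k).symm T) = e (k + 1) S T ^ p)
        (d₀ : LocalNeronLineAt W p v)
        (d : LocalNeronLine W hL ((galRestrictPlace v).comp
          (absGaloisRestrict (Place.Completion (Sum.inr v : Place ℚ)) L))),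
        (bdRPeriodRingData (valuation_place_lt_one p v)).CupLogInjective (logCyclotomic p)
          (localRationalTateRep W p (galRestrictPlace v)) →
        (∀ z : contOneCocycles (localRationalTateRep W p (galRestrictPlace v)).toTopRep,
          (bdRPeriodRingData (valuation_place_lt_one p v)).HasDualExp (logCyclotomic p)
            (localRationalTateRep W p (galRestrictPlace v)) fun σ => z.1 σ) →
        (bdRPeriodRingData (F := L) (p := p) hL).CupLogInjective (logCyclotomic p)
          (localRationalTateRep W p
            ((galRestrictPlace v).comp (absGaloisRestrict (Place.Completion (Sum.inr v : Place ℚ)) L))) →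
        (∀ z : contOneCocycles (localRationalTateRep W p
            ((galRestrictPlace v).comp (absGaloisRestrict (Place.Completion (Sum.inr v : Place ℚ)) L))).toTopRep,
          (bdRPeriodRingData (F := L) (p := p) hL).HasDualExp (logCyclotomic p)
            (localRationalTateRep W p
              ((galRestrictPlace v).comp (absGaloisRestrict (Place.Completion (Sum.inr v : Place ℚ)) L)))
            fun σ => z.1 σ) →
        (∀ (η₀ : contOneCocycles (restrictedTateRep W (Place.Completion (Sum.inr v : Place ℚ)) p).toTopRep)
            (ηT : contOneCocycles ((restrictedTateRep W (Place.Completion (Sum.inr v : Place ℚ)) p).restrict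
              (absGaloisRestrict (Place.Completion (Sum.inr v : Place ℚ)) L)).toTopRep),
            (∀ σ, ηT.1 σ = η₀.1 (absGaloisRestrict (Place.Completion (Sum.inr v : Place ℚ)) L σ)) →
            expStarCoordTower W (F₀ := Place.Completion (Sum.inr v : Place ℚ)) hL d ηT =
              algebraMap (Place.Completion (Sum.inr v : Place ℚ)) L
                (expStarCoord W (valuation_place_lt_one p v) d₀ η₀)) →
        ∃ c : (Place.Completion (Sum.inr v : Place ℚ)), c ≠ 0 ∧
          (∀ (η₀ : contOneCocycles (restrictedTateRep W (Place.Completion (Sum.inr v : Place ℚ)) p).toTopRep)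
              (P : (W.baseChange (Place.Completion (Sum.inr v : Place ℚ))).toAffine.Point),
            ((tatePairingPoint W (Place.Completion (Sum.inr v : Place ℚ)) p e hμ hadd₁ hadd₂ hgal hcompat (oneCocycleClass _ η₀) P : ℤ_[p]) : ℚ_[p]) =
              Algebra.trace ℚ_[p] (Place.Completion (Sum.inr v : Place ℚ))
                (c * expStarCoord W (valuation_place_lt_one p v) d₀ η₀ *
                  padicLogPointFiniteExt w₀ (W.baseChange (Place.Completion (Sum.inr v : Place ℚ))) p P)) ∧
          (∀ (ηT : contOneCocycles ((restrictedTateRep W (Place.Completion (Sum.inr v : Place ℚ)) p).restrict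
                (absGaloisRestrict (Place.Completion (Sum.inr v : Place ℚ)) L)).toTopRep)
              (P : (W.baseChange L).toAffine.Point),
            ((tatePairingPointTower W (Place.Completion (Sum.inr v : Place ℚ)) e hμ hadd₁ hadd₂ hgal hcompat (oneCocycleClass _ ηT) P : ℤ_[p]) : ℚ_[p]) =
              Algebra.trace ℚ_[p] L
                (algebraMap (Place.Completion (Sum.inr v : Place ℚ)) L c * expStarCoordTower W (F₀ := (Place.Completion (Sum.inr v : Place ℚ))) hL d ηT *
                  padicLogPointFiniteExt ν (W.baseChange L) p P))) :
    ∀ (w₀ : Valuation (Place.Completion (Sum.inr v : Place ℚ)) ℝ≥0) [w₀.Compatible]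
        [(W.baseChange (Place.Completion (Sum.inr v : Place ℚ))).IsIntegral w₀.integer]
        (ν : Valuation L ℝ≥0) [ν.Compatible] [(W.baseChange L).IsIntegral ν.integer]
        (d₀ : LocalNeronLineAt W p v)
        (d : LocalNeronLine W hL ((galRestrictPlace v).comp
          (absGaloisRestrict (Place.Completion (Sum.inr v : Place ℚ)) L))),
        (bdRPeriodRingData (valuation_place_lt_one p v)).CupLogInjective (logCyclotomic p)
          (localRationalTateRep W p (galRestrictPlace v)) →
        (∀ z : contOneCocycles (localRationalTateRep W p (galRestrictPlace v)).toTopRep,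
          (bdRPeriodRingData (valuation_place_lt_one p v)).HasDualExp (logCyclotomic p)
            (localRationalTateRep W p (galRestrictPlace v)) fun σ => z.1 σ) →
        (bdRPeriodRingData (F := L) (p := p) hL).CupLogInjective (logCyclotomic p)
          (localRationalTateRep W p
            ((galRestrictPlace v).comp (absGaloisRestrict (Place.Completion (Sum.inr v : Place ℚ)) L))) →
        (∀ z : contOneCocycles (localRationalTateRep W p
            ((galRestrictPlace v).comp (absGaloisRestrict (Place.Completion (Sum.inr v : Place ℚ)) L))).toTopRep,
          (bdRPeriodRingData (F := L) (p := p) hL).HasDualExp (logCyclotomic p)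
            (localRationalTateRep W p
              ((galRestrictPlace v).comp (absGaloisRestrict (Place.Completion (Sum.inr v : Place ℚ)) L)))
            fun σ => z.1 σ) →
        (∀ (η₀ : contOneCocycles (restrictedTateRep W (Place.Completion (Sum.inr v : Place ℚ)) p).toTopRep)
            (ηT : contOneCocycles ((restrictedTateRep W (Place.Completion (Sum.inr v : Place ℚ)) p).restrict
              (absGaloisRestrict (Place.Completion (Sum.inr v : Place ℚ)) L)).toTopRep),
            (∀ σ, ηT.1 σ = η₀.1 (absGaloisRestrict (Place.Completion (Sum.inr v : Place ℚ)) L σ)) →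
            expStarCoordTower W (F₀ := Place.Completion (Sum.inr v : Place ℚ)) hL d ηT =
              algebraMap (Place.Completion (Sum.inr v : Place ℚ)) L
                (expStarCoord W (valuation_place_lt_one p v) d₀ η₀)) →
        ∃ (e : Place.Completion (Sum.inr v : Place ℚ)) (he : e ≠ 0),
          (∀ a₀ : Place.Completion (Sum.inr v : Place ℚ),
            (∃ η₀ : contOneCocycles (restrictedTateRep W (Place.Completion (Sum.inr v : Place ℚ)) p).toTopRep,
                expStarCoord W (valuation_place_lt_one p v) (d₀.smul e he) η₀ = a₀) ↔
              ∀ P : (W.baseChange (Place.Completion (Sum.inr v : Place ℚ))).toAffine.Point,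
                ‖Algebra.trace ℚ_[p] (Place.Completion (Sum.inr v : Place ℚ))
                    (a₀ * padicLogPointFiniteExt w₀
                      (W.baseChange (Place.Completion (Sum.inr v : Place ℚ))) p P)‖ ≤ 1) ∧
          (∀ a : L,
            (∃ ηT : contOneCocycles ((restrictedTateRep W (Place.Completion (Sum.inr v : Place ℚ)) p).restrict
                (absGaloisRestrict (Place.Completion (Sum.inr v : Place ℚ)) L)).toTopRep,
                expStarCoordTower W (F₀ := Place.Completion (Sum.inr v : Place ℚ)) hL
                  (d.smul (algebraMap (Place.Completion (Sum.inr v : Place ℚ)) L e)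
                    ((map_ne_zero (algebraMap (Place.Completion (Sum.inr v : Place ℚ)) L)).mpr he)) ηT = a) ↔
              ∀ P : (W.baseChange L).toAffine.Point,
                ‖Algebra.trace ℚ_[p] L (a * padicLogPointFiniteExt ν (W.baseChange L) p P)‖ ≤ 1) := by
  intro w₀ _ _ ν _ _ d₀ d hcli₀ hde₀ hcli hde hcomp
  have hpQ : (p : ℚ) ≠ 0 := Nat.cast_ne_zero.mpr (Fact.out : p.Prime).ne_zero
  obtain ⟨e, hμ, hadd₁, hadd₂, hgal, hnondeg, hcompat⟩ := WeierstrassCurve.exists_weilPairing_torsionMul_tower W hpQ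
  obtain ⟨c, hc, hrec₀, hrecF⟩ :=
    hrec w₀ ν e hμ hadd₁ hadd₂ hgal hnondeg hcompat d₀ d hcli₀ hde₀ hcli hde hcomp
  exact Literature.NumberTheory.PAdicHodge.exists_smul_range_tower_of_reciprocity W (valuation_place_lt_one p v) w₀ hL ν d₀ d
    (fun η₀ P => tatePairingPoint W (Place.Completion (Sum.inr v : Place ℚ)) p e hμ hadd₁ hadd₂ hgal hcompat
      (oneCocycleClass _ η₀) P)
    (fun η P => tatePairingPointTower W (Place.Completion (Sum.inr v : Place ℚ)) e hμ hadd₁ hadd₂ hgal hcompat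
      (oneCocycleClass _ η) P)
    c hc hrec₀ hrecF
    (exists_contOneCocycles_tatePairingPoint_eq W e hμ hadd₁ hadd₂ hgal hnondeg hcompat)
    (exists_contOneCocycles_tatePairingPointTower_eq W (Place.Completion (Sum.inr v : Place ℚ)) e hμ hadd₁ hadd₂ hgal
      hnondeg hcompat)
    (fun _ hb => Literature.NumberTheory.PAdicHodge.eq_zero_of_forall_trace_mul_padicLog_baseChange_eq_zero W (valuation_place_lt_one p v) w₀ hb)
    (fun _ hb => Literature.NumberTheory.PAdicHodge.eq_zero_of_forall_trace_mul_padicLog_baseChange_eq_zero W hL ν hb)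
    (FormalGroupChart.padicLogPointFiniteExt_baseChange_add W (valuation_place_lt_one p v) w₀)
    (FormalGroupChart.padicLogPointFiniteExt_baseChange_add W hL ν)

end Bridge

/-! ## §2 Skeleton v6 ⟹ skeleton v7: the ∀-fields [REC-tower] gives its body at every cyclotomic tower of every curve over `ℚ` -/

section OfReciprocityLaw

set_option backward.isDefEq.respectTransparency false in
/-- ★ **[REC-tower] (∀ fields) ⟹ [REC-tower] at every curve `W′/ℚ` and every cyclotomic tower `ℚ_v ⊆ ℚ(ζ_m)_w`**, in the packet's instance
keys (the shape of the hypotheses `hRECord` / `hRECss` of `…CellsOfRecTowerAt`, minus the cell conditions): instantiate the cite fact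
`tatePairingPoint_eq_trace_expStar_log_tower` at `K₀ = ℚ`, `W′`, `F₀ = ℚ_v`, `F = ℚ(ζ_m)_w`. Hence skeleton v7's stubs follow from v6's.
[cite: Kato1993LNM1553, Ch. II Thm. 1.4.1 (3)–(4) and §1.2.4] -/
theorem recTowerAt_cyclotomic_of_reciprocityLaw (hrec : tatePairingPoint_eq_trace_expStar_log_tower)
    (W' : WeierstrassCurve ℚ) [W'.IsElliptic] (p : ℕ) [hp : Fact p.Prime] :
    ∀ (m : ℕ) [NeZero m], ¬ p ∣ m →
      ∀ (w : ((primesEquiv (R := 𝓞 ℚ)).symm ⟨p, hp.out⟩).Extension (𝓞 (CyclotomicField m ℚ)))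
        (hw : ((p : ℕ) : 𝓞 (CyclotomicField m ℚ)) ∈ w.1.asIdeal)
        [CharZero (w.1.adicCompletion (CyclotomicField m ℚ))]
        [Fact (¬ IsUnit ((p : ℕ) : integerC (w.1.adicCompletion (CyclotomicField m ℚ))))]
        [IsAdicComplete (Ideal.span {((p : ℕ) : integerC (w.1.adicCompletion (CyclotomicField m ℚ)))}) (integerC (w.1.adicCompletion (CyclotomicField m ℚ)))]
        (hL : valuation (w.1.adicCompletion (CyclotomicField m ℚ)) ((p : ℕ) : (w.1.adicCompletion (CyclotomicField m ℚ))) < 1),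
      letI := LocalField.adicCompletionPadicAlgebra w.1 p hw
      letI : Algebra (Place.Completion (K := ℚ) (Sum.inr ((primesEquiv (R := 𝓞 ℚ)).symm ⟨p, hp.out⟩))) (w.1.adicCompletion (CyclotomicField m ℚ)) :=
        inferInstanceAs (Algebra (((primesEquiv (R := 𝓞 ℚ)).symm ⟨p, hp.out⟩).adicCompletion ℚ) (w.1.adicCompletion (CyclotomicField m ℚ)))
      ∀ (wv : Valuation (Place.Completion (Sum.inr ((primesEquiv (R := 𝓞 ℚ)).symm ⟨p, hp.out⟩) : Place ℚ)) ℝ≥0) [wv.Compatible]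
        [(W'.baseChange (Place.Completion (Sum.inr ((primesEquiv (R := 𝓞 ℚ)).symm ⟨p, hp.out⟩) : Place ℚ))).IsIntegral wv.integer]
        (ν : Valuation (w.1.adicCompletion (CyclotomicField m ℚ)) ℝ≥0) [ν.Compatible] [(W'.baseChange (w.1.adicCompletion (CyclotomicField m ℚ))).IsIntegral ν.integer]
        (e : (k : ℕ) → geomTorsion W' ((p ^ k : ℕ) : ℤ) → geomTorsion W' ((p ^ k : ℕ) : ℤ) → AlgebraicClosure ℚ)
        (hμ : ∀ k S T, e k S T ^ (p ^ k) = 1)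
        (hadd₁ : ∀ k S₁ S₂ T, e k (S₁ + S₂) T = e k S₁ T * e k S₂ T)
        (hadd₂ : ∀ k S T₁ T₂, e k S (T₁ + T₂) = e k S T₁ * e k S T₂)
        (hgal : ∀ k (σ : absoluteGaloisGroup ℚ) (S T : geomTorsion W' ((p ^ k : ℕ) : ℤ)), σ • e k S T = e k (σ • S) (σ • T))
        (_hnondeg : ∀ k (T : geomTorsion W' ((p ^ k : ℕ) : ℤ)), (∀ S, e k S T = 1) → T = 0)
        (hcompat : ∀ k (S T : geomTorsion W' ((p ^ (k + 1) : ℕ) : ℤ)),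
          e k (torsionMulHom W' (p ^ (k + 1)) (p ^ k) p (pow_succ p k).symm S)
            (torsionMulHom W' (p ^ (k + 1)) (p ^ k) p (pow_succ p k).symm T) = e (k + 1) S T ^ p)
        (d₀ : LocalNeronLineAt W' p ((primesEquiv (R := 𝓞 ℚ)).symm ⟨p, hp.out⟩))
        (d : LocalNeronLine W' hL ((galRestrictPlace ((primesEquiv (R := 𝓞 ℚ)).symm ⟨p, hp.out⟩)).comp
          (absGaloisRestrict (Place.Completion (Sum.inr ((primesEquiv (R := 𝓞 ℚ)).symm ⟨p, hp.out⟩) : Place ℚ)) (w.1.adicCompletion (CyclotomicField m ℚ))))),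
        (bdRPeriodRingData (valuation_place_lt_one p ((primesEquiv (R := 𝓞 ℚ)).symm ⟨p, hp.out⟩))).CupLogInjective (logCyclotomic p)
          (localRationalTateRep W' p (galRestrictPlace ((primesEquiv (R := 𝓞 ℚ)).symm ⟨p, hp.out⟩))) →
        (∀ z : contOneCocycles (localRationalTateRep W' p (galRestrictPlace ((primesEquiv (R := 𝓞 ℚ)).symm ⟨p, hp.out⟩))).toTopRep,
          (bdRPeriodRingData (valuation_place_lt_one p ((primesEquiv (R := 𝓞 ℚ)).symm ⟨p, hp.out⟩))).HasDualExp (logCyclotomic p)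
            (localRationalTateRep W' p (galRestrictPlace ((primesEquiv (R := 𝓞 ℚ)).symm ⟨p, hp.out⟩))) fun σ => z.1 σ) →
        (bdRPeriodRingData (F := (w.1.adicCompletion (CyclotomicField m ℚ))) (p := p) hL).CupLogInjective (logCyclotomic p)
          (localRationalTateRep W' p
            ((galRestrictPlace ((primesEquiv (R := 𝓞 ℚ)).symm ⟨p, hp.out⟩)).comp (absGaloisRestrict (Place.Completion (Sum.inr ((primesEquiv (R := 𝓞 ℚ)).symm ⟨p, hp.out⟩) : Place ℚ)) (w.1.adicCompletion (CyclotomicField m ℚ))))) →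
        (∀ z : contOneCocycles (localRationalTateRep W' p
            ((galRestrictPlace ((primesEquiv (R := 𝓞 ℚ)).symm ⟨p, hp.out⟩)).comp (absGaloisRestrict (Place.Completion (Sum.inr ((primesEquiv (R := 𝓞 ℚ)).symm ⟨p, hp.out⟩) : Place ℚ)) (w.1.adicCompletion (CyclotomicField m ℚ))))).toTopRep,
          (bdRPeriodRingData (F := (w.1.adicCompletion (CyclotomicField m ℚ))) (p := p) hL).HasDualExp (logCyclotomic p)
            (localRationalTateRep W' p
              ((galRestrictPlace ((primesEquiv (R := 𝓞 ℚ)).symm ⟨p, hp.out⟩)).comp (absGaloisRestrict (Place.Completion (Sum.inr ((primesEquiv (R := 𝓞 ℚ)).symm ⟨p, hp.out⟩) : Place ℚ)) (w.1.adicCompletion (CyclotomicField m ℚ)))))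
            fun σ => z.1 σ) →
        (∀ (η₀ : contOneCocycles (restrictedTateRep W' (Place.Completion (Sum.inr ((primesEquiv (R := 𝓞 ℚ)).symm ⟨p, hp.out⟩) : Place ℚ)) p).toTopRep)
            (ηT : contOneCocycles ((restrictedTateRep W' (Place.Completion (Sum.inr ((primesEquiv (R := 𝓞 ℚ)).symm ⟨p, hp.out⟩) : Place ℚ)) p).restrict
              (absGaloisRestrict (Place.Completion (Sum.inr ((primesEquiv (R := 𝓞 ℚ)).symm ⟨p, hp.out⟩) : Place ℚ)) (w.1.adicCompletion (CyclotomicField m ℚ)))).toTopRep),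
            (∀ σ, ηT.1 σ = η₀.1 (absGaloisRestrict (Place.Completion (Sum.inr ((primesEquiv (R := 𝓞 ℚ)).symm ⟨p, hp.out⟩) : Place ℚ)) (w.1.adicCompletion (CyclotomicField m ℚ)) σ)) →
            expStarCoordTower W' (F₀ := (Place.Completion (Sum.inr ((primesEquiv (R := 𝓞 ℚ)).symm ⟨p, hp.out⟩) : Place ℚ))) hL d ηT =
              algebraMap (Place.Completion (Sum.inr ((primesEquiv (R := 𝓞 ℚ)).symm ⟨p, hp.out⟩) : Place ℚ)) (w.1.adicCompletion (CyclotomicField m ℚ))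
                (expStarCoord W' (valuation_place_lt_one p ((primesEquiv (R := 𝓞 ℚ)).symm ⟨p, hp.out⟩)) d₀ η₀)) →
        ∃ c : (Place.Completion (Sum.inr ((primesEquiv (R := 𝓞 ℚ)).symm ⟨p, hp.out⟩) : Place ℚ)), c ≠ 0 ∧
          (∀ (η₀ : contOneCocycles (restrictedTateRep W' (Place.Completion (Sum.inr ((primesEquiv (R := 𝓞 ℚ)).symm ⟨p, hp.out⟩) : Place ℚ)) p).toTopRep)
              (P : (W'.baseChange (Place.Completion (Sum.inr ((primesEquiv (R := 𝓞 ℚ)).symm ⟨p, hp.out⟩) : Place ℚ))).toAffine.Point),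
            ((tatePairingPoint W' (Place.Completion (Sum.inr ((primesEquiv (R := 𝓞 ℚ)).symm ⟨p, hp.out⟩) : Place ℚ)) p e hμ hadd₁ hadd₂ hgal hcompat (oneCocycleClass _ η₀) P : ℤ_[p]) : ℚ_[p]) =
              Algebra.trace ℚ_[p] (Place.Completion (Sum.inr ((primesEquiv (R := 𝓞 ℚ)).symm ⟨p, hp.out⟩) : Place ℚ))
                (c * expStarCoord W' (valuation_place_lt_one p ((primesEquiv (R := 𝓞 ℚ)).symm ⟨p, hp.out⟩)) d₀ η₀ *
                  padicLogPointFiniteExt wv (W'.baseChange (Place.Completion (Sum.inr ((primesEquiv (R := 𝓞 ℚ)).symm ⟨p, hp.out⟩) : Place ℚ))) p P)) ∧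
          (∀ (ηT : contOneCocycles ((restrictedTateRep W' (Place.Completion (Sum.inr ((primesEquiv (R := 𝓞 ℚ)).symm ⟨p, hp.out⟩) : Place ℚ)) p).restrict
                (absGaloisRestrict (Place.Completion (Sum.inr ((primesEquiv (R := 𝓞 ℚ)).symm ⟨p, hp.out⟩) : Place ℚ)) (w.1.adicCompletion (CyclotomicField m ℚ)))).toTopRep)
              (P : (W'.baseChange (w.1.adicCompletion (CyclotomicField m ℚ))).toAffine.Point),
            ((tatePairingPointTower W' (Place.Completion (Sum.inr ((primesEquiv (R := 𝓞 ℚ)).symm ⟨p, hp.out⟩) : Place ℚ)) e hμ hadd₁ hadd₂ hgal hcompat (oneCocycleClass _ ηT) P : ℤ_[p]) : ℚ_[p]) =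
              Algebra.trace ℚ_[p] (w.1.adicCompletion (CyclotomicField m ℚ))
                (algebraMap (Place.Completion (Sum.inr ((primesEquiv (R := 𝓞 ℚ)).symm ⟨p, hp.out⟩) : Place ℚ)) (w.1.adicCompletion (CyclotomicField m ℚ)) c * expStarCoordTower W' (F₀ := (Place.Completion (Sum.inr ((primesEquiv (R := 𝓞 ℚ)).symm ⟨p, hp.out⟩) : Place ℚ))) hL d ηT *
                  padicLogPointFiniteExt ν (W'.baseChange (w.1.adicCompletion (CyclotomicField m ℚ))) p P)) := by
  intro m _ _ w hw _ _ _ hL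
  letI := LocalField.adicCompletionPadicAlgebra w.1 p hw
  letI : Algebra (Place.Completion (K := ℚ) (Sum.inr ((primesEquiv (R := 𝓞 ℚ)).symm ⟨p, hp.out⟩)))
      (w.1.adicCompletion (CyclotomicField m ℚ)) :=
    inferInstanceAs (Algebra (((primesEquiv (R := 𝓞 ℚ)).symm ⟨p, hp.out⟩).adicCompletion ℚ)
      (w.1.adicCompletion (CyclotomicField m ℚ)))
  intro wv _ _ ν _ _ e hμ hadd₁ hadd₂ hgal hnondeg hcompat d₀ d hcli₀ hde₀ hcli hde hcomp
  exact hrec W' (valuation_place_lt_one p ((primesEquiv (R := 𝓞 ℚ)).symm ⟨p, hp.out⟩)) wv hL ν e hμ hadd₁ hadd₂ hgal hnondeg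
    hcompat d₀ d hcli₀ hde₀ hcli hde hcomp

end OfReciprocityLaw

end Summit.BirchSwinnertonDyer.BirchSwinnertonDyer.Theorems.StarredOptimalManinUnitFiveSevenRecTowerAtBridge

end
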